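import Summits.Ventures.HodgeRepro.DihedralQuadThreshold

/-!
# The first members of the dihedral mechanism: `D₁₂` (order `24`) and `D₂₀` (order `40`)

Blind re-derivation cell `pub-hodge-repro`, seat `p1` (gen 11).  Route-2 g30's enumeration (INBOX L1130) found the
dihedral rectangle on `D₁₂` (24 instances per pointed `4`-set, `k = 3`) and on `D₂₀` (120, `k = 5`); both are now
one-line corollaries of `exists_dihedralQuad` on Mathlib's `DihedralGroup n` (order `2n`): `s = sr 0`, `t = sr 2`,
`st = r 2` of order `n/2`, `c = r (n/2)`, and `8k = 2n` exactly — the threshold `8k ≤ |G|` is attained.  Every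
hypothesis is decided on the group table.
-/

set_option autoImplicit false

open Finset DihedralGroup
open scoped Pointwise

namespace HodgeRepro.CosetQuad

/-- `D₁₂`, the dihedral group of order `24`. -/
abbrev D12 : Type := DihedralGroup 12

/-- `r 6` is a complex conjugation of `D₁₂`. -/
theorem isComplexConj_r6_D12 : IsComplexConj (r 6 : D12) := by decide

/-- `st = r 2` has order `6` in `D₁₂`. -/
theorem orderOf_sr0_mul_sr2_D12 : orderOf ((sr 0 : D12) * sr 2) = 2 * 3 :=
  (orderOf_eq_iff (by norm_num)).2 (by decide)

/-- **`D₁₂` carries the dihedral rectangle** (`k = 3`, `8k = 24 = |D₁₂|`): a CM type for `c = r 6` whose twists by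
`1, sr 0, sr 2, sr 0 · sr 2 = r 2` are `SumTwo` without a conjugate pair. -/
theorem exists_dihedralQuad_D12 :
    ∃ Φ : Finset D12, IsCMType (r 6) Φ ∧
      SumTwo ![Φ, rmul Φ (sr 0), rmul Φ (sr 2), rmul Φ (sr 0 * sr 2)] ∧
      ∀ i j : Fin 4, ![Φ, rmul Φ (sr 0), rmul Φ (sr 2), rmul Φ (sr 0 * sr 2)] j ≠
        (r 6 : D12) • ![Φ, rmul Φ (sr 0), rmul Φ (sr 2), rmul Φ (sr 0 * sr 2)] i :=
  exists_dihedralQuad (k := 3) isComplexConj_r6_D12 (by decide) (by decide) orderOf_sr0_mul_sr2_D12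
    (by norm_num) (by decide) (by decide) (by rw [DihedralGroup.card])

/-- `D₂₀`, the dihedral group of order `40`. -/
abbrev D20 : Type := DihedralGroup 20

/-- `r 10` is a complex conjugation of `D₂₀`. -/
theorem isComplexConj_r10_D20 : IsComplexConj (r 10 : D20) := by decide

/-- `st = r 2` has order `10` in `D₂₀`. -/
theorem orderOf_sr0_mul_sr2_D20 : orderOf ((sr 0 : D20) * sr 2) = 2 * 5 :=
  (orderOf_eq_iff (by norm_num)).2 (by decide)

/-- **`D₂₀` carries the dihedral rectangle** (`k = 5`, `8k = 40 = |D₂₀|`). -/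
theorem exists_dihedralQuad_D20 :
    ∃ Φ : Finset D20, IsCMType (r 10) Φ ∧
      SumTwo ![Φ, rmul Φ (sr 0), rmul Φ (sr 2), rmul Φ (sr 0 * sr 2)] ∧
      ∀ i j : Fin 4, ![Φ, rmul Φ (sr 0), rmul Φ (sr 2), rmul Φ (sr 0 * sr 2)] j ≠
        (r 10 : D20) • ![Φ, rmul Φ (sr 0), rmul Φ (sr 2), rmul Φ (sr 0 * sr 2)] i :=
  exists_dihedralQuad (k := 5) isComplexConj_r10_D20 (by decide) (by decide) orderOf_sr0_mul_sr2_D20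
    (by norm_num) (by decide) (by decide) (by rw [DihedralGroup.card])

/-- On `D₁₂` the threshold is attained: NO dihedral rectangle with `st` of order `6` lives in a group of order
below `24` — e.g. the dihedral criterion at `D₆` (order `12`) is false. -/
theorem not_exists_dihedralQuad_D6 :
    ¬ ∃ Φ : Finset (DihedralGroup 6), IsCMType (r 3) Φ ∧
      SumTwo ![Φ, rmul Φ (sr 0), rmul Φ (sr 1), rmul Φ (sr 0 * sr 1)] ∧
      ∀ i j : Fin 4, ![Φ, rmul Φ (sr 0), rmul Φ (sr 1), rmul Φ (sr 0 * sr 1)] j ≠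
        (r 3 : DihedralGroup 6) • ![Φ, rmul Φ (sr 0), rmul Φ (sr 1), rmul Φ (sr 0 * sr 1)] i := by
  intro h
  have h24 := (exists_dihedralQuad_iff (G := DihedralGroup 6) (k := 3) (by decide) (by decide) (by decide)
    ((orderOf_eq_iff (by norm_num)).2 (by decide)) (by norm_num) (by decide) (by decide)).1 h
  rw [DihedralGroup.card] at h24
  omega

end HodgeRepro.CosetQuad
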